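import Literature.AnabelianGeometry.SemiGraphs.ThetaRayFrameOrder
import Literature.AnabelianGeometry.SemiGraphs.ThetaRayFrameShift
import Literature.AnabelianGeometry.SemiGraphs.TemperedPiFrameTransport
import HarnessLib

/-!
# One step of the two-level frame induction at `𝒢_θ` (typed-form audit of [SemiAnbd] Thm 3.7 (iv) clause 2,
# row «B9·ANCHOR-FREE-PAIR», brick K-B4b/1)

Mochizuki, *Semi-graphs of anabelioids*, Publ. RIMS **42** (2006), §3, Theorem 3.7 (iii)/(iv) pp. 40–41,
Remark 2.2.1 p. 24 [cite: MochizukiSemiAnbd2006, Thm 3.7(iv) p.41].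

PROOF-ONLY file (abc-iut cell, layer L3, seat abc-iut-L3-d4 gen 5; row «B9·ANCHOR-FREE-PAIR@𝒢_θ» (L3-lead
β50/γ10); frontier / erratum-grade label — typed-form audit of the cell's ∀-countable typing of Thm 3.7 (iv) at
abc-iut-L3-d1's countermodel `𝒢_θ(p,n)`, OUTSIDE the [IUTchIII] Cor. 3.12 cone; 0 definitions, no named fact).
Desk memo `HOME/staging/L3/L3-d4/g5/B9-ANCHOR-FREE-PAIR.md`, steps (S1)+(S2): the INDUCTION STEP of «deep fixed
points of `x = c^{p^m}` project onto fixed points of `c`».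

The invariant at a tree vertex `P.vertex N'` of the deep level `N'` (point sequence `P` over the vertex `w` of
the ray, NORMALISED frame — conjugator absorbed into `P`):
(I1) `ρ_{N'}(x) = σ_{N'}^{b_*(λ)}` with `‖p^m‖ ≤ ‖λ‖`;  (I2) `ρ_n(c) = σ_n^{b_*(u)}` (the SAME branch `b` at `w`).
`thetaRayFreeProP_frame_step`: if `x` fixes a branch `β` of the level-`N'` tree at `P.vertex N'`, the invariant
TRANSPORTS to a point sequence `P'` through the other end of the edge of `β`, with the same `u` — by
abc-iut-L3-d4's transport (p473740), frame shift (p471798; parameter `λ` certified by the order bookkeeping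
p477446 at the FIXED level `n`, where the vertex is far) and the level-`n` triviality of the characteristic
open core `G(d_n)` (abc-iut-L3-t6's `gal_eq_one_of_mem_charOpenCore`, consumed as the hypothesis `hV`) and of
the far twists (`θ_{n_k} ≡ id mod G(d_n)`, hypothesis `htwist`).  All level-dependent thresholds refer to the
FIXED shallow level `n`; the deep level `N'` only has to exceed the frame-shift level.

Nothing of [SemiAnbd] is asserted; nothing bears on [IUTchIII] Cor. 3.12; typed ≠ proved.
-/

noncomputable section

namespace Literature.AnabelianGeometry.SemiGraphs

open CategoryTheory Filter Topology Multiplicative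
open ProfiniteSemiGraph ProfiniteSemiGraph.GaloisLevelData
open Literature.AnabelianGeometry.SemiGraphs.FreeProPRankTwo

namespace ProfiniteSemiGraph

variable (p : ℕ) [hp : Fact p.Prime] (n : ℕ → ℕ)

/-- The other branch of an edge of the ray: `(k, !s)`; it abuts to `k + 1` resp. `k`. [cite: MochizukiSemiAnbd2006, §1 p.11] -/
theorem ray_abuts_not (b : ℕ × Bool) :
    SemiGraph.ray.abuts (b.1, !b.2) = some (if b.2 then b.1 else b.1 + 1) := by
  rw [SemiGraph.ray_abuts]
  cases b.2 <;> rfl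

/-- At a vertex `w` of `𝒢_θ(p,n)` with `θ_{n_w} ≡ id mod G(d)`, the two branch homomorphisms at `w` agree modulo
`G(d)` elementwise: `b_*(u) = t · b'_*(u)` with `t ∈ G(d)`, for any two branches `b, b'` at `w`.
[cite: MochizukiSemiAnbd2006, Def 2.1 p.22] -/
theorem thetaRayFreeProP_brHom_congr_of_twist (d : ℕ) {w : ℕ}
    (htw : ∀ g : Grp p, θ p (n w) g * g⁻¹ ∈ charOpenCore (Grp p) d)
    (b b' : ℕ × Bool) (hb : SemiGraph.ray.abuts b = some w) (hb' : SemiGraph.ray.abuts b' = some w)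
    (u : Multiplicative ℤ_[p]) (y y' : Grp p) (hy : y = (thetaRayFreeProP p n).brHom b w hb u)
    (hy' : y' = (thetaRayFreeProP p n).brHom b' w hb' u) :
    ∃ t : Grp p, t ∈ charOpenCore (Grp p) d ∧ y = t * y' := by
  haveI : (charOpenCore (Grp p) d).Normal := FreeProPRankTwo.normal_charOpenCore p d
  subst hy hy'
  -- each branch at `w` is `(w-1, true)` (value `α u`) or `(w, false)` (value `θ_{n_w} (α u)`)
  have key : ∀ (b : ℕ × Bool) (hb : SemiGraph.ray.abuts b = some w),
      (((thetaRayFreeProP p n).brHom b w hb u : Grp p) = α p u) ∨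
        (((thetaRayFreeProP p n).brHom b w hb u : Grp p) = θ p (n w) (α p u)) := by
    rintro ⟨j, _ | _⟩ hb
    · have hw : w = j := (ray_abuts_false_iff j w).mp hb
      subst hw
      exact Or.inr rfl
    · exact Or.inl rfl
  have h1 : θ p (n w) (α p u) = (θ p (n w) (α p u) * (α p u)⁻¹) * α p u := by group
  rcases key b hb with e | e <;> rcases key b' hb' with e' | e' <;> rw [e, e']
  · exact ⟨1, one_mem _, (one_mul _).symm⟩
  · refine ⟨(θ p (n w) (α p u) * (α p u)⁻¹)⁻¹, inv_mem (htw _), ?_⟩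
    conv_lhs => rw [← inv_mul_cancel_left (θ p (n w) (α p u) * (α p u)⁻¹) (α p u), ← h1]
  · exact ⟨θ p (n w) (α p u) * (α p u)⁻¹, htw _, h1⟩
  · exact ⟨1, one_mem _, (one_mul _).symm⟩

/-- **THE INDUCTION STEP** (see the module docstring). [cite: MochizukiSemiAnbd2006, Thm 3.7(iv) p.41] -/
theorem thetaRayFreeProP_frame_step (h36 : (thetaRayFreeProP p n).Prop36Hypotheses)
    (P₀ : ((thetaRayFreeProP p n).galoisLevelData h36).PointSeq h36.isCountable (0 : ℕ))
    (c : ((thetaRayFreeProP p n).galoisLevelData h36).temperedPi h36.isCountable) (Nc : ℕ → ℕ)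
    (hN : ∀ j k, Nc j ≤ k →
      ((thetaRayFreeProP p n).galoisLevelData h36).proj h36.isCountable j c =
        ((thetaRayFreeProP p n).galoisLevelData h36).proj h36.isCountable j
          ((rayPointSeq (D := (thetaRayFreeProP p n).galoisLevelData h36) thetaRay_ham thetaRay_hap
            thetaRay_hmp P₀ (k + 1)).decompHom
            ((thetaRayFreeProP p n).brHom (k, true) (k + 1) (thetaRay_hap k) (ofAdd (1 : ℤ_[p])))))
    (m N' : ℕ) {n₀ : ℕ} (hnN : n₀ ≤ N')
    (hne : (((thetaRayFreeProP p n).galoisLevelData h36).proj h36.isCountable n₀ c) ^ p ^ m ≠ 1)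
    (d : ℕ)
    (hV : ∀ (w : ℕ) (P : ((thetaRayFreeProP p n).galoisLevelData h36).PointSeq h36.isCountable w) (v : Grp p),
      v ∈ charOpenCore (Grp p) d → P.gal n₀ v = 1)
    (k₁ : ℕ) (htwist : ∀ k, k₁ ≤ k → ∀ g : Grp p, θ p (n k) g * g⁻¹ ∈ charOpenCore (Grp p) d)
    (hshift : ∀ (w : ℕ) (P : ((thetaRayFreeProP p n).galoisLevelData h36).PointSeq h36.isCountable w)
      (b₁ b₂ : ℕ × Bool) (hb₁ : SemiGraph.ray.abuts b₁ = some w) (hb₂ : SemiGraph.ray.abuts b₂ = some w)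
      (f₁ f₂ y₁ y₂ : Grp p) (k k₂ : Multiplicative ℤ_[p]), ‖(p : ℤ_[p]) ^ m‖ ≤ ‖k₂.toAdd‖ →
      y₁ = (thetaRayFreeProP p n).brHom b₁ w hb₁ k → y₂ = (thetaRayFreeProP p n).brHom b₂ w hb₂ k₂ →
      P.gal N' (f₁ * y₁ * f₁⁻¹) = P.gal N' (f₂ * y₂ * f₂⁻¹) →
      ∃ (π : Multiplicative ℤ_[p]) (y v : Grp p), y = (thetaRayFreeProP p n).brHom b₂ w hb₂ π ∧
        v ∈ charOpenCore (Grp p) d ∧ f₂⁻¹ * f₁ = y * v)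
    {w : ℕ} (hw₁ : k₁ ≤ w) (hw₂ : Nc n₀ + 1 ≤ w)
    (P : ((thetaRayFreeProP p n).galoisLevelData h36).PointSeq h36.isCountable w)
    (b : ℕ × Bool) (hb : SemiGraph.ray.abuts b = some w) (l u : Multiplicative ℤ_[p]) (y yu : Grp p)
    (hy : y = (thetaRayFreeProP p n).brHom b w hb l) (hyu : yu = (thetaRayFreeProP p n).brHom b w hb u)
    (hl : ‖(p : ℤ_[p]) ^ m‖ ≤ ‖l.toAdd‖)
    (hI1 : ((thetaRayFreeProP p n).galoisLevelData h36).proj h36.isCountable N' (c ^ p ^ m) = P.gal N' y)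
    (hI2 : ((thetaRayFreeProP p n).galoisLevelData h36).proj h36.isCountable n₀ c = P.gal n₀ yu)
    (β : (((thetaRayFreeProP p n).galoisLevelData h36).tree N').Branch)
    (hβ : (((thetaRayFreeProP p n).galoisLevelData h36).tree N').abuts β = some (P.vertex N'))
    (hfix : (((thetaRayFreeProP p n).galoisLevelData h36).treeAct h36.isCountable N' (c ^ p ^ m)).hom.branchMap β
      = β) :
    ∃ (w' : ℕ) (P' : ((thetaRayFreeProP p n).galoisLevelData h36).PointSeq h36.isCountable w')
      (b' : ℕ × Bool) (hb' : SemiGraph.ray.abuts b' = some w') (l' : Multiplicative ℤ_[p]) (y' yu' : Grp p),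
      y' = (thetaRayFreeProP p n).brHom b' w' hb' l' ∧ yu' = (thetaRayFreeProP p n).brHom b' w' hb' u ∧
      ‖(p : ℤ_[p]) ^ m‖ ≤ ‖l'.toAdd‖ ∧
      ((thetaRayFreeProP p n).galoisLevelData h36).proj h36.isCountable N' (c ^ p ^ m) = P'.gal N' y' ∧
      ((thetaRayFreeProP p n).galoisLevelData h36).proj h36.isCountable n₀ c = P'.gal n₀ yu' ∧
      (((thetaRayFreeProP p n).galoisLevelData h36).tree N').Joins
          ((((thetaRayFreeProP p n).galoisLevelData h36).tree N').edgeOf β) (P.vertex N') (P'.vertex N') ∧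
      P.vertex N' ≠ P'.vertex N' := by
  classical
  let Dg := (thetaRayFreeProP p n).galoisLevelData h36
  have hc36 := h36.isCountable
  set x := c ^ p ^ m with hx
  -- the base branch of `β` and its partner
  set bβ : ℕ × Bool := (Dg.treeProj N').branchMap β with hbβ_def
  have hbβ : SemiGraph.ray.abuts bβ = some w := by
    have h1 := (Dg.treeProj N').abuts_branchMap β (P.vertex N') hβ
    rw [P.treeProj_vertexMap_vertex N'] at h1
    exact h1
  set bβ' : ℕ × Bool := (bβ.1, !bβ.2) with hbβ'_def
  have hbb' : bβ ≠ bβ' := by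
    intro h
    have := congrArg Prod.snd h
    cases hs : bβ.2 <;> simp [hbβ'_def, hs] at this
  set w' : ℕ := (if bβ.2 then bβ.1 else bβ.1 + 1) with hw'_def
  have hb' : SemiGraph.ray.abuts bβ' = some w' := ray_abuts_not bβ
  -- TRANSPORT across `β`
  obtain ⟨P', f', k', hframe', halign, hjoins, hne'⟩ :=
    P.exists_transport_of_branchMap_eq SemiGraph.ray_isConnected N' x bβ hbβ bβ' hbb' rfl w' hb' β rfl hβ hfix
  -- everything read in `Grp p`
  set fG : Grp p := f' with hfG
  let brβ : Multiplicative ℤ_[p] →* Grp p :=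
    (MonoidHom.id (Grp p)).comp ((thetaRayFreeProP p n).brHom bβ w hbβ).toMonoidHom
  let brβ' : Multiplicative ℤ_[p] →* Grp p :=
    (MonoidHom.id (Grp p)).comp ((thetaRayFreeProP p n).brHom bβ' w' hb').toMonoidHom
  let brb : Multiplicative ℤ_[p] →* Grp p :=
    (MonoidHom.id (Grp p)).comp ((thetaRayFreeProP p n).brHom b w hb).toMonoidHom
  have hbrβ : ∀ t, brβ t = (thetaRayFreeProP p n).brHom bβ w hbβ t := fun t => rfl
  have hbrβ' : ∀ t, brβ' t = (thetaRayFreeProP p n).brHom bβ' w' hb' t := fun t => rfl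
  have hbrb : ∀ t, brb t = (thetaRayFreeProP p n).brHom b w hb t := fun t => rfl
  have hframeG : Dg.proj hc36 N' x = P.gal N' (fG * brβ k' * fG⁻¹) := hframe'
  have halignG : ∀ t : Multiplicative ℤ_[p], P'.decompHom (brβ' t) = P.decompHom (fG * brβ t * fG⁻¹) :=
    fun t => halign t
  -- the group homomorphisms `ψ_N := ρ_N ∘ ψ_P`
  let ψn : Grp p →* Dg.Gal hc36 n₀ := (Dg.proj hc36 n₀).comp P.decompHom
  have hψn : ∀ z : Grp p, P.gal n₀ z = ψn z := fun z => rfl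
  -- FRAME SHIFT at `P.vertex N'`: `fG = b_*(π) · v`
  have hcmp : P.gal N' (fG * brβ k' * fG⁻¹) = P.gal N' ((1 : Grp p) * y * (1 : Grp p)⁻¹) := by
    rw [one_mul, inv_one, mul_one, ← hI1, hx]
    exact hframeG.symm
  obtain ⟨π, yπ, v, hyπ, hv, hf'⟩ := hshift w P bβ b hbβ hb fG 1 (brβ k') y k' l hl (hbrβ k') hy hcmp
  rw [inv_one, one_mul] at hf'
  have hyπ' : yπ = brb π := hyπ
  have hyu' : yu = brb u := hyu
  -- the new frame
  refine ⟨w', P', bβ', hb', k', brβ' k', brβ' u, hbrβ' k', hbrβ' u, ?_, ?_, ?_, hjoins, hne'⟩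
  · -- `‖p^m‖ ≤ ‖k'‖`: order bookkeeping at the FIXED level `n₀` (the vertex `w` is far there)
    have hproj : P.gal n₀ (fG * brβ k' * fG⁻¹) = (Dg.proj hc36 n₀ c) ^ p ^ m := by
      rw [hψn, ← map_pow]
      change Dg.proj hc36 n₀ (P.decompHom (fG * brβ k' * fG⁻¹)) = Dg.proj hc36 n₀ x
      rw [← Dg.mapLE_proj hc36 hnN (P.decompHom _), ← Dg.mapLE_proj hc36 hnN x, hframeG]
      rfl
    exact thetaRayFreeProP_frame_norm_ge p n h36 P₀ c Nc hN m n₀ hne w hw₂ bβ hbβ P fG (brβ k') k' (hbrβ k')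
      hproj
  · -- (I1) at `P'`: alignment of the transport
    rw [← P'.proj_decompHom, halignG k', P.proj_decompHom]
    exact hframeG
  · -- (I2) at `P'`
    rw [← P'.proj_decompHom, halignG u, P.proj_decompHom]
    -- `P.gal n₀ (fG · b_*(u) · fG⁻¹) = ρ_{n₀}(c)` with `fG = yπ · v`
    have hvn : ψn v = 1 := by rw [← hψn]; exact hV w P v hv
    -- the two branch values at `w` agree modulo `G(d)`
    obtain ⟨t, ht, hybu_eq⟩ := thetaRayFreeProP_brHom_congr_of_twist p n d (htwist w hw₁) bβ b hbβ hb u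
      (brβ u) yu (hbrβ u) hyu
    have htn : ψn t = 1 := by rw [← hψn]; exact hV w P t ht
    -- `yπ · yu · yπ⁻¹ = yu` (the edge group is commutative)
    have hcomm : yπ * yu * yπ⁻¹ = yu := by
      rw [hyπ', hyu', ← map_mul, ← map_inv, ← map_mul, mul_inv_cancel_comm]
    have e1 : ψn (fG * brβ u * fG⁻¹) = ψn fG * ψn (brβ u) * (ψn fG)⁻¹ := by
      rw [map_mul, map_mul, map_inv]
    have e2 : ψn fG = ψn yπ * ψn v := by rw [hf', map_mul]
    have e3 : ψn (brβ u) = ψn t * ψn yu := by rw [hybu_eq, map_mul]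
    change Dg.proj hc36 n₀ c = ψn (fG * brβ u * fG⁻¹)
    rw [e1, e2, e3, hvn, htn, mul_one, one_mul, ← map_mul, ← map_inv, ← map_mul, hcomm, ← hψn]
    exact hI2

end ProfiniteSemiGraph

end Literature.AnabelianGeometry.SemiGraphs

end
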